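import Summits.AtomisticToContinuum.FouriersLaw.Theorems.EmbeddedDrudeMourreAbelThermodynamicLimitOfLowerBound
import Summits.AtomisticToContinuum.FouriersLaw.Theorems.EmbeddedDrudeMourreAbelThermodynamicLimitRegularityOfRegularWitness
import Summits.AtomisticToContinuum.FouriersLaw.Theorems.EmbeddedDrudeMourreNessUnique
import HarnessLib

/-!
# (R) `UniformAbelianRegularity` IS EXACTLY the common-limit statement (line `loomis-compact-horizon-witness`, rev 5;
item stmt-AtomisticToContinuum-12596; `--supports` file, closes nothing)

For `P = pinnedChain ω₂ lam β γ` (all `> 0`) and `T > 0` the core residual (R) = `StaticAbelianSqueeze.UniformAbelianRegularity`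
(item stmt-AtomisticToContinuum-13416: `|∫₀^∞ (1 - e^{-νt}) c_N| ≤ εN` eventually in `N`, uniformly in small `ν`) is EQUIVALENT, over
the landed theorems, to: there are a regular pair `(μ*, D*)` (shift-invariant DLR state, `μ*`-preserving dynamics with absolutely
convergent correlations) and ONE real `L` such that `∫₀^∞ e^{-νt} C_{D*}(t) dt → L` (`ν ↓ 0`) AND `T²·D_N → L` along every steady
family — existence of the Abel-regularised Green–Kubo value of the infinite chain, convergence of the finite open-chain responses,
and their IDENTIFICATION.  (⇒) is `exists_regularPair_commonLimit_of_regularity` (A p126906 + (M) p127009 + S3, `Uniq` discharged by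
`nessUnique_proof`); (⇐) is NEC-R `stub_regularityAtOfRegularWitness` applied to the witness `(μ*, D*, L/T²)` and the canonical
steady family.  No definitions, no named facts.
-/

noncomputable section

open MeasureTheory Filter Set
open scoped Topology NNReal BigOperators

namespace Summit.AtomisticToContinuum.FouriersLaw.Theorems.AbelThermodynamicLimit.LoomisCompactHorizonWitness

open Literature.MathematicalPhysics.KineticTheory.HeatConduction

/-- **(R) ⟺ common limit.**  `UniformAbelianRegularity` holds iff for all parameters (`> 0`) and `T > 0` some regular pair
`(μ*, D*)` and real `L` have `∫₀^∞e^{-νt}C_{D*} → L` (`ν ↓ 0`) and `T²·Dn N → L` along every steady family with responses `Dn`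
at `T`. [cite: KunduDharNarayan2009, eqs. (8)–(15)] [cite: BonettoLebowitzReyBellet2000, §7 eq. (37)] -/
theorem stub_regularityIffCommonLimit :
    Summit.AtomisticToContinuum.FouriersLaw.Theses.StaticAbelianSqueeze.UniformAbelianRegularity ↔
      ∀ ω₂ lam β γ : ℝ, 0 < ω₂ → 0 < lam → 0 < β → 0 < γ → ∀ T : ℝ, 0 < T →
        ∃ (μT : MeasureTheory.Measure Literature.MathematicalPhysics.KineticTheory.HeatConduction.ChainConfig)
            (D : Literature.MathematicalPhysics.KineticTheory.HeatConduction.InfiniteChainDynamics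
              (Literature.MathematicalPhysics.KineticTheory.HeatConduction.pinnedChain ω₂ lam β γ)) (L : ℝ),
          (Literature.MathematicalPhysics.KineticTheory.HeatConduction.pinnedChain ω₂ lam β γ).IsChainGibbsMeasure T μT ∧
          Literature.MathematicalPhysics.KineticTheory.HeatConduction.IsShiftInvariant μT ∧
          D.PreservesMeasure μT ∧ (∀ t : ℝ, D.HasAbsConvergentCorrelation μT t) ∧
          Filter.Tendsto (fun ν : ℝ =>
              MeasureTheory.integral (MeasureTheory.volume.restrict (Set.Ioi (0:ℝ)))
                (fun t : ℝ => Real.exp (-(ν * t)) * D.currentCorrelation μT t))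
            (nhdsWithin (0:ℝ) (Set.Ioi 0)) (nhds L) ∧
          ∀ (μ : (N : ℕ) → ℝ → ℝ → MeasureTheory.Measure
                (Literature.MathematicalPhysics.KineticTheory.HeatConduction.PhaseSpace N)) (Dn : ℕ → ℝ),
            (∀ (N : ℕ) (T_L T_R : ℝ), 0 < T_L → 0 < T_R →
              (Literature.MathematicalPhysics.KineticTheory.HeatConduction.pinnedChain
                  ω₂ lam β γ).IsSteadyState N T_L T_R (μ N T_L T_R)) →
            (∀ N : ℕ, Filter.Tendsto (fun δ : ℝ =>
                (Literature.MathematicalPhysics.KineticTheory.HeatConduction.pinnedChain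
                    ω₂ lam β γ).totalCurrent (μ N (T + δ / 2) (T - δ / 2)) / δ)
              (nhdsWithin 0 {(0 : ℝ)}ᶜ) (nhds (Dn N))) →
            Filter.Tendsto (fun N : ℕ => T ^ 2 * Dn N) Filter.atTop (nhds L) := by
  constructor
  · intro hR ω₂ lam β γ hω hl hβ hγ T hT
    have hU := Summit.AtomisticToContinuum.FouriersLaw.Theorems.nessUnique_proof ω₂ lam β γ hω hl hβ hγ
    obtain ⟨μT, D, L, hG, hS, -, -, hP, hAC, hL, hKubo⟩ :=
      exists_regularPair_commonLimit_of_regularity hR ω₂ lam β γ hω hl hβ hγ hU T hT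
    exact ⟨μT, D, L, hG, hS, hP, hAC, hL, hKubo⟩
  · intro h ω₂ lam β γ hω hl hβ hγ T hT
    have hU := Summit.AtomisticToContinuum.FouriersLaw.Theorems.nessUnique_proof ω₂ lam β γ hω hl hβ hγ
    obtain ⟨μT, D, L, hG, hS, hP, hAC, hL, hKubo⟩ := h ω₂ lam β γ hω hl hβ hγ T hT
    obtain ⟨μc, Dc, hμc, hDc⟩ := exists_steadyFamily_response ω₂ lam β γ hω hl hβ hγ hU T hT
    have hT2 : (T ^ 2) ≠ 0 := pow_ne_zero 2 hT.ne'
    have hAbel : Tendsto (fun ν : ℝ => (T ^ 2)⁻¹ *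
        MeasureTheory.integral (MeasureTheory.volume.restrict (Set.Ioi (0:ℝ)))
          (fun t : ℝ => Real.exp (-(ν * t)) * D.currentCorrelation μT t))
        (nhdsWithin (0:ℝ) (Set.Ioi 0)) (𝓝 ((T ^ 2)⁻¹ * L)) := hL.const_mul _
    have hconv : Tendsto Dc atTop (𝓝 ((T ^ 2)⁻¹ * L)) := by
      have := (hKubo μc Dc hμc hDc).const_mul ((T ^ 2)⁻¹)
      simpa [← mul_assoc, inv_mul_cancel₀ hT2] using this
    exact stub_regularityAtOfRegularWitness ω₂ lam β γ hω hl hβ hγ hU T hT μT D ((T ^ 2)⁻¹ * L) hG hS hP hAC hAbel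
      μc Dc hμc hDc hconv

end Summit.AtomisticToContinuum.FouriersLaw.Theorems.AbelThermodynamicLimit.LoomisCompactHorizonWitness

end
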